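import Literature.Computability.MetaComplexity.GridTseitinLift
import HarnessLib

/-!
# Grid coordinates for `gridGraph t` (row-major vertices, adjacency in `|Δr| + |Δc| = 1` form, block translation)

[topic Combinatorics/Optimization]

Bookkeeping module G3 of the G♭ programme (`GridCorCliqueFace`, Aboulker–Fiorini–Huynh–Macchia–Seif 2019, Thm. 6:
a face of `COR(G_{t,t})` projecting onto `COR(K_h)`; design memo HOME/lmr/NOTE-p10g2-GFLAT-gate-crossover-design.md §3–§4).
The tree's grid `Literature.Computability.MetaComplexity.gridGraph t` lives on `Fin (t·t)` with vertex `a` at row `a / t`,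
column `a % t` [HastadRisse2025, §2]; the layout of AFHMS Thm. 6 [AboulkerEtAl2019, §3, p.5 L21] places a fixed
`K × K` pattern into block `(i, j)` at rows `K i … K i + K − 1`, columns `K j … K j + K − 1`.  This file provides, with
NO definitions — every statement is about arbitrary vertices `a b : Fin (t·t)` under coordinate hypotheses
`(a : ℕ) = r·t + c` (build the vertex itself with `vtx_spec`):

* `vtx_spec`, `exists_vtx` — row-major coordinates (`r·t + c < t·t`, its row is `r`, its column is `c`; every vertex
  has coordinates);
* `gridAdj_iff_of_val_eq` — adjacency ⇔ same row and columns differ by `1`, or same column and rows differ by `1`;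
  `not_gridAdj_of_ne_of_ne` (different row AND column: the diagonals of a grid `4`-cycle),
  `not_gridAdj_of_dist_ne_one` (Manhattan distance `≠ 1`);
* `block_lt`, `gridAdj_block_iff` — inside block `(i, j)` adjacency of `(K i + r, K j + c)` and `(K i + r', K j + c')` is
  adjacency of the OFFSETS, uniformly in `(i, j)` (so one `decide`d `K × K` fact transports to every block);
  `gridAdj_block_right`, `gridAdj_block_down` — the port edges between horizontally / vertically neighbouring blocks;
  `not_gridAdj_block_of_ne`, `not_gridAdj_block_of_ne_row` — interiors of different blocks never touch.

Honest framing: arithmetic only; no statement of AFHMS 2019 is proved here; G♭ (stmt 27045), K1 (26254) and VP ≠ VNP are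
OPEN and not moved by this file.
-/

namespace Literature.Combinatorics.Optimization

open Literature.Computability.MetaComplexity (gridGraph gridAdj)

/-! ### Row-major coordinates -/

/-- **Coordinate vertex**: for `r, c < t` the number `r·t + c` is `< t·t`, has row `r` and column `c` (row-major
convention of the tree's `gridGraph`). [cite: HastadRisse2025, §2] -/
theorem vtx_spec {t r c : ℕ} (hr : r < t) (hc : c < t) :
    r * t + c < t * t ∧ (r * t + c) / t = r ∧ (r * t + c) % t = c := by
  have ht : 0 < t := by omega
  refine ⟨?_, ?_, ?_⟩
  · calc r * t + c < r * t + t := by omega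
      _ = (r + 1) * t := by ring
      _ ≤ t * t := Nat.mul_le_mul_right t hr
  · rw [Nat.add_comm, Nat.add_mul_div_right _ _ ht, Nat.div_eq_of_lt hc, Nat.zero_add]
  · rw [Nat.add_comm, Nat.add_mul_mod_self_right, Nat.mod_eq_of_lt hc]

/-- Every vertex of `Fin (t·t)` has coordinates (row `a / t`, column `a % t`). [cite: HastadRisse2025, §2] -/
theorem exists_vtx {t : ℕ} (a : Fin (t * t)) : ∃ r c : ℕ, r < t ∧ c < t ∧ (a : ℕ) = r * t + c := by
  have ha : (a : ℕ) < t * t := a.is_lt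
  have ht : 0 < t := Nat.pos_of_ne_zero (by rintro rfl; simp at ha)
  exact ⟨(a : ℕ) / t, (a : ℕ) % t, Nat.div_lt_of_lt_mul ha, Nat.mod_lt _ ht, (Nat.div_add_mod' (a : ℕ) t).symm⟩

/-! ### Adjacency in coordinates -/

/-- **Grid adjacency in coordinates**: same row and adjacent columns, or same column and adjacent rows.
[cite: HastadRisse2025, §2] -/
theorem gridAdj_iff_of_val_eq {t r c r' c' : ℕ} {a b : Fin (t * t)} (ha : (a : ℕ) = r * t + c)
    (hb : (b : ℕ) = r' * t + c') (hc : c < t) (hc' : c' < t) :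
    (gridGraph t).Adj a b ↔ (r = r' ∧ (c + 1 = c' ∨ c' + 1 = c)) ∨ (c = c' ∧ (r + 1 = r' ∨ r' + 1 = r)) := by
  have hr : r < t := by
    by_contra h
    have h1 : t * t ≤ r * t := Nat.mul_le_mul_right t (not_lt.1 h)
    have h2 := a.is_lt
    omega
  have hr' : r' < t := by
    by_contra h
    have h1 : t * t ≤ r' * t := Nat.mul_le_mul_right t (not_lt.1 h)
    have h2 := b.is_lt
    omega
  obtain ⟨-, hdiv, hmod⟩ := vtx_spec hr hc
  obtain ⟨-, hdiv', hmod'⟩ := vtx_spec hr' hc'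
  show gridAdj t a b ↔ _
  unfold gridAdj
  rw [ha, hb, hdiv, hdiv', hmod, hmod']

/-- Vertices in different rows AND different columns are not adjacent (the diagonals of a grid `4`-cycle).
[cite: HastadRisse2025, §2] -/
theorem not_gridAdj_of_ne_of_ne {t r c r' c' : ℕ} {a b : Fin (t * t)} (ha : (a : ℕ) = r * t + c)
    (hb : (b : ℕ) = r' * t + c') (hc : c < t) (hc' : c' < t) (hrr : r ≠ r') (hcc : c ≠ c') :
    ¬ (gridGraph t).Adj a b := by
  rw [gridAdj_iff_of_val_eq ha hb hc hc']
  rintro (⟨h, -⟩ | ⟨h, -⟩)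
  · exact hrr h
  · exact hcc h

/-- Vertices at Manhattan distance `≠ 1` are not adjacent. [cite: HastadRisse2025, §2] -/
theorem not_gridAdj_of_dist_ne_one {t r c r' c' : ℕ} {a b : Fin (t * t)} (ha : (a : ℕ) = r * t + c)
    (hb : (b : ℕ) = r' * t + c') (hc : c < t) (hc' : c' < t)
    (h : (max r r' - min r r') + (max c c' - min c c') ≠ 1) :
    ¬ (gridGraph t).Adj a b := by
  rw [gridAdj_iff_of_val_eq ha hb hc hc']
  omega

/-! ### Blocks of pitch `K` -/

/-- A block coordinate is a grid coordinate: `K i + r < t` when `K n ≤ t`, `i < n`, `r < K` (the `h × h` array of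
`K × K` gadgets inside `G_{t,t}`). [cite: AboulkerEtAl2019, §3 (proof of Thm. 6)] -/
theorem block_lt {K n t i r : ℕ} (hKn : K * n ≤ t) (hi : i < n) (hr : r < K) : K * i + r < t := by
  calc K * i + r < K * i + K := by omega
    _ = K * (i + 1) := by ring
    _ ≤ K * n := Nat.mul_le_mul_left K hi
    _ ≤ t := hKn

/-- **Adjacency inside a block is adjacency of the offsets**, uniformly in the block index `(i, j)`.
[cite: AboulkerEtAl2019, §3 (proof of Thm. 6: the same gadget in every block)] -/
theorem gridAdj_block_iff {K t i j r c r' c' : ℕ} {a b : Fin (t * t)}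
    (ha : (a : ℕ) = (K * i + r) * t + (K * j + c)) (hb : (b : ℕ) = (K * i + r') * t + (K * j + c'))
    (hC : K * j + c < t) (hC' : K * j + c' < t) :
    (gridGraph t).Adj a b ↔ (r = r' ∧ (c + 1 = c' ∨ c' + 1 = c)) ∨ (c = c' ∧ (r + 1 = r' ∨ r' + 1 = r)) := by
  rw [gridAdj_iff_of_val_eq ha hb hC hC']
  generalize K * i = x at *
  generalize K * j = y at *
  omega

/-- **Right port edge**: the last column of block `(i, j)` is adjacent to the first column of block `(i, j+1)` in the
same row. [cite: AboulkerEtAl2019, §3 (proof of Thm. 6: wires between neighbouring gadgets)] -/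
theorem gridAdj_block_right {K t i j r : ℕ} {a b : Fin (t * t)} (hK : 0 < K)
    (ha : (a : ℕ) = (K * i + r) * t + (K * j + (K - 1))) (hb : (b : ℕ) = (K * i + r) * t + (K * (j + 1) + 0))
    (hC : K * j + (K - 1) < t) (hC' : K * (j + 1) + 0 < t) : (gridGraph t).Adj a b := by
  rw [gridAdj_iff_of_val_eq ha hb hC hC']
  left
  refine ⟨rfl, Or.inl ?_⟩
  rw [Nat.mul_succ]
  omega

/-- **Down port edge**: the last row of block `(i, j)` is adjacent to the first row of block `(i+1, j)` in the same
column. [cite: AboulkerEtAl2019, §3 (proof of Thm. 6: wires between neighbouring gadgets)] -/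
theorem gridAdj_block_down {K t i j c : ℕ} {a b : Fin (t * t)} (hK : 0 < K)
    (ha : (a : ℕ) = (K * i + (K - 1)) * t + (K * j + c)) (hb : (b : ℕ) = (K * (i + 1) + 0) * t + (K * j + c))
    (hC : K * j + c < t) : (gridGraph t).Adj a b := by
  rw [gridAdj_iff_of_val_eq ha hb hC hC]
  right
  refine ⟨rfl, Or.inl ?_⟩
  rw [Nat.mul_succ]
  omega

/-- **Interiors of different blocks of one block-row are not adjacent**: block columns `j ≠ j'` and column offsets
away from the block boundary (`0 < c`, `c + 1 < K`, same for `c'`) ⇒ not adjacent, whatever the rows.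
[cite: AboulkerEtAl2019, §3 (proof of Thm. 6: gadgets interact only through their ports)] -/
theorem not_gridAdj_block_of_ne {K t i i' j j' r r' c c' : ℕ} {a b : Fin (t * t)} (hjj : j ≠ j') (hc0 : 0 < c)
    (hcK : c + 1 < K) (hc0' : 0 < c') (hcK' : c' + 1 < K)
    (ha : (a : ℕ) = (K * i + r) * t + (K * j + c)) (hb : (b : ℕ) = (K * i' + r') * t + (K * j' + c'))
    (hC : K * j + c < t) (hC' : K * j' + c' < t) : ¬ (gridGraph t).Adj a b := by
  rw [gridAdj_iff_of_val_eq ha hb hC hC']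
  rcases Nat.lt_or_gt_of_ne hjj with h | h
  · have h1 : K * j + K ≤ K * j' := by rw [← Nat.mul_succ]; exact Nat.mul_le_mul_left K h
    omega
  · have h1 : K * j' + K ≤ K * j := by rw [← Nat.mul_succ]; exact Nat.mul_le_mul_left K h
    omega

/-- **Interiors of different blocks of one block-column are not adjacent**: block rows `i ≠ i'` and row offsets away
from the block boundary ⇒ not adjacent, whatever the columns. [cite: AboulkerEtAl2019, §3 (proof of Thm. 6)] -/
theorem not_gridAdj_block_of_ne_row {K t i i' j j' r r' c c' : ℕ} {a b : Fin (t * t)} (hii : i ≠ i') (hr0 : 0 < r)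
    (hrK : r + 1 < K) (hr0' : 0 < r') (hrK' : r' + 1 < K)
    (ha : (a : ℕ) = (K * i + r) * t + (K * j + c)) (hb : (b : ℕ) = (K * i' + r') * t + (K * j' + c'))
    (hC : K * j + c < t) (hC' : K * j' + c' < t) : ¬ (gridGraph t).Adj a b := by
  rw [gridAdj_iff_of_val_eq ha hb hC hC']
  rcases Nat.lt_or_gt_of_ne hii with h | h
  · have h1 : K * i + K ≤ K * i' := by rw [← Nat.mul_succ]; exact Nat.mul_le_mul_left K h
    omega
  · have h1 : K * i' + K ≤ K * i := by rw [← Nat.mul_succ]; exact Nat.mul_le_mul_left K h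
    omega

end Literature.Combinatorics.Optimization
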